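import Literature.NumberTheory.Automorphic.RankinSelbergLocal
import HarnessLib

/-!
# Equivariance of the local Rankin–Selberg zeta integral under the unipotent group `Y_{n,m}`

Second quasi-invariance property in Jacquet–Piatetski-Shapiro–Shalika's proof of the local
functional equation (1983, §2.7; Cogdell 2004, §6.3, property (ii) of the bilinear forms `B_s`):
with `Y_{n,m} = {(I_{m+1} *; 0 x) | x ∈ N_{n-m-1}} ≤ U_n`,

`Ψ(s; ρ(y) W, W') = ψ_U(y) Ψ(s; W, W')`   for all `y ∈ Y_{n,m}`   (`ρ` = right translation).

The mechanism: `diag(h, 1) y diag(h, 1)⁻¹` (`h ∈ GL_m`) is again upper unitriangular with the same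
super-diagonal sum as `y` (the first `m + 1` columns of `y` are those of the identity, so the
conjugation only mixes the rows of the top-right block, and the `(m, m+1)` entry is untouched),
whence `W(diag(h,1) y) = ψ_U(diag(h,1) y diag(h,1)⁻¹) W(diag(h,1)) = ψ_U(y) W(diag(h,1))` for
`W` left-`(U_n, ψ_U)`-equivariant; the identity is pointwise in the integrand, so it needs no
hypothesis on the measure. Companion of `RankinSelbergLocalInvariance` (property (i),
quasi-invariance under `GL_m`); the two files are independent.

* `unipotentY R n m`: the subgroup `Y_{n,m}` of `GL_n(R)` (upper unitriangular matrices whose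
  columns of index `≤ m` are identity columns).
* `glCorner_mul_apply_inl/inr`, `mul_glCorner_apply_inl/inr`: rows/columns of `diag(h,1) M`,
  `M diag(h,1)` in block coordinates.
* `glCorner_conj_mem_upperUnitriangular`, `whittakerCharFun_glCorner_conj`: the conjugate
  `diag(h,1) y diag(h,1)⁻¹` lies in `U_n` with `ψ_U`-value `ψ_U(y)`.
* `rsIntegrand_rightTranslate_unipotentY`, `rsKernel_rightTranslate_unipotentY`,
  `rsZeta_rightTranslate_unipotentY`: the `(Y_{n,m}, ψ_U)`-equivariance of integrand, kernel and
  zeta integral.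

## References

* H. Jacquet, I. I. Piatetski-Shapiro, J. Shalika, *Rankin–Selberg convolutions*, Amer. J. Math.
  105 (1983), §2.7. [JacquetPiatetskiShapiroShalika1983]
* J. W. Cogdell, *Lectures on `L`-functions, converse theorems, and functoriality for `GL_n`*,
  Fields Inst. Monogr. 20 (2004), §6.3 (p. 48 of the author's PDF: "`Ψ(s, π(y)W, W') = ψ(y)Ψ(s, W, W')`
  for all `y ∈ Y_{n,m}(k) = {(I_{m+1} *; 0 x) | x ∈ N_{n-m-1}(k)}`"). [Cogdell2004]
-/

set_option autoImplicit false

open scoped NNReal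
open Matrix MeasureTheory

noncomputable section

namespace Literature.NumberTheory.Automorphic

/-! ### Rows and columns of `diag(h, 1) M` and `M diag(h, 1)` -/

section BlockAPI

variable {R : Type*} [CommRing R] {n m : ℕ}

/-- Rows of `diag(g, 1) M` in the first block: `(diag(g,1) M)_{a, q} = ∑_{a'} g_{a a'} M_{a', q}`.
[folklore] -/
theorem glCorner_mul_apply_inl (h : m ≤ n) (g : GL (Fin m) R) (M : Matrix (Fin n) (Fin n) R)
    (a : Fin m) (q : Fin n) :
    (((glCorner R h g : GL (Fin n) R) : Matrix (Fin n) (Fin n) R) * M) (finBlockEquiv h (Sum.inl a)) q =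
      ∑ a', (g : Matrix (Fin m) (Fin m) R) a a' * M (finBlockEquiv h (Sum.inl a')) q := by
  rw [Matrix.mul_apply, ← Equiv.sum_comp (finBlockEquiv h), Fintype.sum_sum_type]
  simp

/-- Rows of `diag(g, 1) M` in the second block are those of `M`. [folklore] -/
theorem glCorner_mul_apply_inr (h : m ≤ n) (g : GL (Fin m) R) (M : Matrix (Fin n) (Fin n) R)
    (b : Fin (n - m)) (q : Fin n) :
    (((glCorner R h g : GL (Fin n) R) : Matrix (Fin n) (Fin n) R) * M) (finBlockEquiv h (Sum.inr b)) q =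
      M (finBlockEquiv h (Sum.inr b)) q := by
  rw [Matrix.mul_apply, ← Equiv.sum_comp (finBlockEquiv h), Fintype.sum_sum_type]
  simp [Matrix.one_apply]

/-- Columns of `M diag(g, 1)` in the first block: `(M diag(g,1))_{p, a'} = ∑_a M_{p, a} g_{a a'}`.
[folklore] -/
theorem mul_glCorner_apply_inl (h : m ≤ n) (g : GL (Fin m) R) (M : Matrix (Fin n) (Fin n) R)
    (p : Fin n) (a' : Fin m) :
    (M * ((glCorner R h g : GL (Fin n) R) : Matrix (Fin n) (Fin n) R)) p (finBlockEquiv h (Sum.inl a')) =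
      ∑ a, M p (finBlockEquiv h (Sum.inl a)) * (g : Matrix (Fin m) (Fin m) R) a a' := by
  rw [Matrix.mul_apply, ← Equiv.sum_comp (finBlockEquiv h), Fintype.sum_sum_type]
  simp

/-- Columns of `M diag(g, 1)` in the second block are those of `M`. [folklore] -/
theorem mul_glCorner_apply_inr (h : m ≤ n) (g : GL (Fin m) R) (M : Matrix (Fin n) (Fin n) R)
    (p : Fin n) (b' : Fin (n - m)) :
    (M * ((glCorner R h g : GL (Fin n) R) : Matrix (Fin n) (Fin n) R)) p (finBlockEquiv h (Sum.inr b')) =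
      M p (finBlockEquiv h (Sum.inr b')) := by
  rw [Matrix.mul_apply, ← Equiv.sum_comp (finBlockEquiv h), Fintype.sum_sum_type]
  simp [Matrix.one_apply]

end BlockAPI

/-! ### The subgroup `Y_{n,m}` -/

section UnipotentY

variable {R : Type*} [CommRing R] {n m : ℕ}

/-- If the `j`-th column of `y` is the `j`-th column of the identity, then `(A y)_{i j} = A_{i j}`.
[folklore] -/
theorem mul_apply_eq_of_col_eq_one {y : Matrix (Fin n) (Fin n) R} {j : Fin n}
    (hy : ∀ i, y i j = (1 : Matrix (Fin n) (Fin n) R) i j) (A : Matrix (Fin n) (Fin n) R) (i : Fin n) :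
    (A * y) i j = A i j := by
  rw [Matrix.mul_apply]
  simp_rw [hy, Matrix.one_apply]
  simp

variable (n m R) in
/-- The subgroup `Y_{n,m} = {(I_{m+1} *; 0 x) | x ∈ N_{n-m-1}}` of `GL_n(R)` (Cogdell 2004, §6.3;
Jacquet–Piatetski-Shapiro–Shalika 1983, §2.7): upper unitriangular matrices whose columns of
index `≤ m` (the first `m + 1` columns) are the corresponding columns of the identity. It is the
group of unipotent `y` with `Ψ(s; ρ(y) W, W') = ψ_U(y) Ψ(s; W, W')`. (Meaningful for `m < n`; for
`m + 1 ≥ n` it is trivial.) [cite: Cogdell2004, §6.3] -/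
def unipotentY : Subgroup (GL (Fin n) R) where
  carrier := {y | y ∈ upperUnitriangular (Fin n) R ∧ ∀ i j : Fin n, (j : ℕ) ≤ m →
    (y : Matrix (Fin n) (Fin n) R) i j = (1 : Matrix (Fin n) (Fin n) R) i j}
  one_mem' := ⟨one_mem _, fun i j _ => rfl⟩
  mul_mem' := by
    rintro y z ⟨hy, hy'⟩ ⟨hz, hz'⟩
    refine ⟨mul_mem hy hz, fun i j hj => ?_⟩
    rw [Units.val_mul, mul_apply_eq_of_col_eq_one (fun k => hz' k j hj), hy' i j hj]
  inv_mem' := by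
    rintro y ⟨hy, hy'⟩
    refine ⟨inv_mem hy, fun i j hj => ?_⟩
    have h1 : (((y⁻¹ * y : GL (Fin n) R)) : Matrix (Fin n) (Fin n) R) i j =
        (1 : Matrix (Fin n) (Fin n) R) i j := by
      rw [inv_mul_cancel, Units.val_one]
    rwa [Units.val_mul, mul_apply_eq_of_col_eq_one (fun k => hy' k j hj)] at h1

/-- Membership in `Y_{n,m}`. [folklore] -/
theorem mem_unipotentY_iff (y : GL (Fin n) R) :
    y ∈ unipotentY R n m ↔ y ∈ upperUnitriangular (Fin n) R ∧ ∀ i j : Fin n, (j : ℕ) ≤ m →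
      (y : Matrix (Fin n) (Fin n) R) i j = (1 : Matrix (Fin n) (Fin n) R) i j :=
  Iff.rfl

/-- `Y_{n,m} ≤ U_n`. [folklore] -/
theorem unipotentY_le_upperUnitriangular : unipotentY R n m ≤ upperUnitriangular (Fin n) R :=
  fun _ hy => hy.1

variable {h : m ≤ n} {y : GL (Fin n) R}

/-- Entries of `y ∈ Y_{n,m}` in the first `m` columns, block coordinates `(inl, inl)`: `δ`. [folklore] -/
theorem apply_inl_inl_of_mem_unipotentY (hy : y ∈ unipotentY R n m) (a a' : Fin m) :
    (y : Matrix (Fin n) (Fin n) R) (finBlockEquiv h (Sum.inl a)) (finBlockEquiv h (Sum.inl a')) =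
      if a = a' then 1 else 0 := by
  rw [hy.2 _ _ (by simp), Matrix.one_apply]
  simp

/-- Entries of `y ∈ Y_{n,m}` in the first `m` columns, block coordinates `(inr, inl)`: `0`. [folklore] -/
theorem apply_inr_inl_of_mem_unipotentY (hy : y ∈ unipotentY R n m) (b : Fin (n - m)) (a' : Fin m) :
    (y : Matrix (Fin n) (Fin n) R) (finBlockEquiv h (Sum.inr b)) (finBlockEquiv h (Sum.inl a')) = 0 := by
  rw [hy.2 _ _ (by simp), Matrix.one_apply]
  simp

/-- Entries of `y ∈ Y_{n,m}` in column `m` (block coordinate `inr 0`, for `m < n`), rows in the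
first block: `0`. [folklore] -/
theorem apply_inl_inr_zero_of_mem_unipotentY (hmn : m < n) (hy : y ∈ unipotentY R n m) (a : Fin m) :
    (y : Matrix (Fin n) (Fin n) R) (finBlockEquiv hmn.le (Sum.inl a))
      (finBlockEquiv hmn.le (Sum.inr ⟨0, Nat.sub_pos_of_lt hmn⟩)) = 0 := by
  rw [hy.2 _ _ (by simp), Matrix.one_apply]
  simp

/-! ### Conjugating `Y_{n,m}` by `diag(h, 1)` -/

/-- `(inl, inl)` block of `diag(g,1) y diag(g,1)⁻¹` for `y ∈ Y_{n,m}`: the identity. [folklore] -/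
theorem glCorner_conj_apply_inl_inl (hy : y ∈ unipotentY R n m) (g : GL (Fin m) R) (a a' : Fin m) :
    ((glCorner R h g * y * (glCorner R h g)⁻¹ : GL (Fin n) R) : Matrix (Fin n) (Fin n) R)
        (finBlockEquiv h (Sum.inl a)) (finBlockEquiv h (Sum.inl a')) =
      (1 : Matrix (Fin m) (Fin m) R) a a' := by
  rw [← map_inv, Units.val_mul, Units.val_mul, mul_glCorner_apply_inl]
  simp_rw [glCorner_mul_apply_inl, apply_inl_inl_of_mem_unipotentY hy]
  simp only [mul_ite, mul_one, mul_zero, Finset.sum_ite_eq', Finset.mem_univ, if_true]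
  rw [← Matrix.mul_apply, ← Units.val_mul, mul_inv_cancel, Units.val_one]

/-- `(inr, inl)` block of `diag(g,1) y diag(g,1)⁻¹` for `y ∈ Y_{n,m}`: zero. [folklore] -/
theorem glCorner_conj_apply_inr_inl (hy : y ∈ unipotentY R n m) (g : GL (Fin m) R)
    (b : Fin (n - m)) (a' : Fin m) :
    ((glCorner R h g * y * (glCorner R h g)⁻¹ : GL (Fin n) R) : Matrix (Fin n) (Fin n) R)
        (finBlockEquiv h (Sum.inr b)) (finBlockEquiv h (Sum.inl a')) = 0 := by
  rw [← map_inv, Units.val_mul, Units.val_mul, mul_glCorner_apply_inl]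
  simp_rw [glCorner_mul_apply_inr, apply_inr_inl_of_mem_unipotentY hy]
  simp

/-- `(inr, inr)` block of `diag(g,1) y diag(g,1)⁻¹`: that of `y`. [folklore] -/
theorem glCorner_conj_apply_inr_inr (g : GL (Fin m) R) (b b' : Fin (n - m)) :
    ((glCorner R h g * y * (glCorner R h g)⁻¹ : GL (Fin n) R) : Matrix (Fin n) (Fin n) R)
        (finBlockEquiv h (Sum.inr b)) (finBlockEquiv h (Sum.inr b')) =
      (y : Matrix (Fin n) (Fin n) R) (finBlockEquiv h (Sum.inr b)) (finBlockEquiv h (Sum.inr b')) := by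
  rw [← map_inv, Units.val_mul, Units.val_mul, mul_glCorner_apply_inr, glCorner_mul_apply_inr]

/-- The `(·, m)` entries of `diag(g,1) y diag(g,1)⁻¹` (`y ∈ Y_{n,m}`, `m < n`) with row in the first
block vanish, as for `y`. [folklore] -/
theorem glCorner_conj_apply_inl_inr_zero (hmn : m < n) (hy : y ∈ unipotentY R n m)
    (g : GL (Fin m) R) (a : Fin m) :
    ((glCorner R hmn.le g * y * (glCorner R hmn.le g)⁻¹ : GL (Fin n) R) : Matrix (Fin n) (Fin n) R)
        (finBlockEquiv hmn.le (Sum.inl a))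
        (finBlockEquiv hmn.le (Sum.inr ⟨0, Nat.sub_pos_of_lt hmn⟩)) = 0 := by
  rw [← map_inv, Units.val_mul, Units.val_mul, mul_glCorner_apply_inr, glCorner_mul_apply_inl]
  simp_rw [apply_inl_inr_zero_of_mem_unipotentY hmn hy]
  simp

/-- **`diag(g, 1)` normalises `Y_{n,m}` into `U_n`**: for `y ∈ Y_{n,m}` and `g ∈ GL_m(R)` the
conjugate `diag(g,1) y diag(g,1)⁻¹` is upper unitriangular (its `(inl,inl)` block is `1`, its
`(inr,inl)` block is `0`, its `(inr,inr)` block is that of `y`). (Cogdell 2004, §6.3.) [cite: Cogdell2004, §6.3] -/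
theorem glCorner_conj_mem_upperUnitriangular (hy : y ∈ unipotentY R n m) (g : GL (Fin m) R) :
    glCorner R h g * y * (glCorner R h g)⁻¹ ∈ upperUnitriangular (Fin n) R := by
  have hu := (mem_upperUnitriangular_iff _).1 hy.1
  rw [mem_upperUnitriangular_iff]
  refine ⟨fun i j hij => ?_, fun i => ?_⟩
  · obtain ⟨x, rfl⟩ := (finBlockEquiv h).surjective i
    obtain ⟨x', rfl⟩ := (finBlockEquiv h).surjective j
    simp only [id, Fin.lt_def] at hij
    rcases x with a | b <;> rcases x' with a' | b'
    · simp only [coe_finBlockEquiv_inl] at hij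
      rw [glCorner_conj_apply_inl_inl hy, Matrix.one_apply_ne]
      rintro rfl
      omega
    · simp only [coe_finBlockEquiv_inl, coe_finBlockEquiv_inr] at hij
      omega
    · exact glCorner_conj_apply_inr_inl hy g b a'
    · simp only [coe_finBlockEquiv_inr] at hij
      rw [glCorner_conj_apply_inr_inr]
      exact hu.1 (by simp only [id, Fin.lt_def, coe_finBlockEquiv_inr]; omega)
  · obtain ⟨x, rfl⟩ := (finBlockEquiv h).surjective i
    rcases x with a | b
    · rw [glCorner_conj_apply_inl_inl hy, Matrix.one_apply_eq]
    · rw [glCorner_conj_apply_inr_inr]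
      exact hu.2 _

/-- **The conjugation preserves the generic character**: for `y ∈ Y_{n,m}` (`m < n`) and
`g ∈ GL_m(R)`, `∑ᵢ (diag(g,1) y diag(g,1)⁻¹)_{i,i+1} = ∑ᵢ y_{i,i+1}` — the super-diagonal entries
in the first `m + 1` columns vanish on both sides and the others live in the untouched
`(inr, inr)` block. [cite: Cogdell2004, §6.3] -/
theorem superdiagSum_glCorner_conj (hmn : m < n) (hy : y ∈ unipotentY R n m) (g : GL (Fin m) R) :
    superdiagSum ⟨glCorner R hmn.le g * y * (glCorner R hmn.le g)⁻¹,
        glCorner_conj_mem_upperUnitriangular hy g⟩ =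
      superdiagSum ⟨y, hy.1⟩ := by
  rw [superdiagSum_def, superdiagSum_def, sum_sum_finBlockEquiv hmn.le,
    sum_sum_finBlockEquiv hmn.le (f := fun i j => if (i : ℕ) + 1 = j then
      ((y : GL (Fin n) R) : Matrix (Fin n) (Fin n) R) i j else 0)]
  refine Fintype.sum_congr _ _ fun x => Fintype.sum_congr _ _ fun x' => ?_
  rcases x with a | b <;> rcases x' with a' | b'
  · simp only [coe_finBlockEquiv_inl]
    split_ifs with hc
    · rw [glCorner_conj_apply_inl_inl hy, apply_inl_inl_of_mem_unipotentY hy, Matrix.one_apply_ne, if_neg]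
      · rintro rfl; omega
      · rintro rfl; omega
    · rfl
  · simp only [coe_finBlockEquiv_inl, coe_finBlockEquiv_inr]
    split_ifs with hc
    · have hb' : b' = ⟨0, Nat.sub_pos_of_lt hmn⟩ := Fin.ext (by simp; omega)
      subst hb'
      rw [glCorner_conj_apply_inl_inr_zero hmn hy, apply_inl_inr_zero_of_mem_unipotentY hmn hy]
    · rfl
  · simp only [coe_finBlockEquiv_inl, coe_finBlockEquiv_inr]
    rw [if_neg (by omega), if_neg (by omega)]
  · simp only [coe_finBlockEquiv_inr]
    rw [glCorner_conj_apply_inr_inr]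

/-- `ψ_U(diag(g,1) y diag(g,1)⁻¹) = ψ_U(y)` for `y ∈ Y_{n,m}`, `g ∈ GL_m`. [cite: Cogdell2004, §6.3] -/
theorem whittakerCharFun_glCorner_conj (ψ : AddChar R Circle) (hmn : m < n)
    (hy : y ∈ unipotentY R n m) (g : GL (Fin m) R) :
    whittakerCharFun ψ ⟨glCorner R hmn.le g * y * (glCorner R hmn.le g)⁻¹,
        glCorner_conj_mem_upperUnitriangular hy g⟩ =
      whittakerCharFun ψ ⟨y, hy.1⟩ := by
  rw [whittakerCharFun_apply, whittakerCharFun_apply, superdiagSum_glCorner_conj hmn hy g]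

end UnipotentY

/-! ### `(Y_{n,m}, ψ_U)`-equivariance of the zeta integral -/

section Equivariance

variable {F : Type*} [Field F] [ValuativeRel F] [TopologicalSpace F]
  [IsNonarchimedeanLocalField F] {n m : ℕ}

/-- **Pointwise `(Y_{n,m}, ψ_U)`-equivariance of the JPSS integrand**: for `W` left-equivariant
under `(U_n, ψ_U)` and `y ∈ Y_{n,m}`,
`rsIntegrand (ρ(y) W) W' s g = ψ_U(y) · rsIntegrand W W' s g`, because
`W(diag(g⁻¹,1) y) = W((diag(g⁻¹,1) y diag(g⁻¹,1)⁻¹) diag(g⁻¹,1)) = ψ_U(y) W(diag(g⁻¹,1))`.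
[cite: Cogdell2004, §6.3] -/
theorem rsIntegrand_rightTranslate_unipotentY (hmn : m < n) {ψ : AddChar F Circle}
    {W : GL (Fin n) F → ℂ}
    (hW : ∀ (u : ↥(upperUnitriangular (Fin n) F)) (g : GL (Fin n) F),
      W ((u : GL (Fin n) F) * g) = whittakerCharFun ψ u * W g)
    (W' : GL (Fin m) F → ℂ) (s : ℂ) {y : GL (Fin n) F} (hy : y ∈ unipotentY F n m)
    (g : GL (Fin m) F) :
    rsIntegrand hmn (fun x => W (x * y)) W' s g =
      whittakerCharFun ψ ⟨y, hy.1⟩ * rsIntegrand hmn W W' s g := by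
  simp only [rsIntegrand]
  have key : glCorner F hmn.le g⁻¹ * y =
      (glCorner F hmn.le g⁻¹ * y * (glCorner F hmn.le g⁻¹)⁻¹) * glCorner F hmn.le g⁻¹ := by
    rw [inv_mul_cancel_right]
  rw [key, ← Subgroup.coe_mk (upperUnitriangular (Fin n) F)
    (glCorner F hmn.le g⁻¹ * y * (glCorner F hmn.le g⁻¹)⁻¹) (glCorner_conj_mem_upperUnitriangular hy _),
    hW, whittakerCharFun_glCorner_conj ψ hmn hy]
  ring

omit [ValuativeRel F] [TopologicalSpace F] [IsNonarchimedeanLocalField F] in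
/-- Right translates of left-`(U, ψ_U)`-equivariant functions are left-`(U, ψ_U)`-equivariant
(local copy of `leftEquivariant_rightTranslate` of `RankinSelbergLocalInvariance`). [folklore] -/
private theorem leftEquivariant_rightTranslate_aux {k : ℕ} {ψ : AddChar F Circle}
    {W : GL (Fin k) F → ℂ}
    (hW : ∀ (u : ↥(upperUnitriangular (Fin k) F)) (g : GL (Fin k) F),
      W ((u : GL (Fin k) F) * g) = whittakerCharFun ψ u * W g)
    (h : GL (Fin k) F) (u : ↥(upperUnitriangular (Fin k) F)) (g : GL (Fin k) F) :
    (fun x => W (x * h)) ((u : GL (Fin k) F) * g) = whittakerCharFun ψ u * (fun x => W (x * h)) g := by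
  simp only [mul_assoc, hW]

/-- **`(Y_{n,m}, ψ_U)`-equivariance of the Rankin–Selberg kernel** (left-equivariant `W`, `W'`).
[cite: Cogdell2004, §6.3] -/
theorem rsKernel_rightTranslate_unipotentY (hmn : m < n) {ψ : AddChar F Circle}
    {W : GL (Fin n) F → ℂ} {W' : GL (Fin m) F → ℂ}
    (hW : ∀ (u : ↥(upperUnitriangular (Fin n) F)) (g : GL (Fin n) F),
      W ((u : GL (Fin n) F) * g) = whittakerCharFun ψ u * W g)
    (hW' : ∀ (u : ↥(upperUnitriangular (Fin m) F)) (g : GL (Fin m) F),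
      W' ((u : GL (Fin m) F) * g) = whittakerCharFun ψ⁻¹ u * W' g)
    (s : ℂ) {y : GL (Fin n) F} (hy : y ∈ unipotentY F n m)
    (x : GL (Fin m) F ⧸ upperUnitriangular (Fin m) F) :
    rsKernel hmn (fun g => W (g * y)) W' s x =
      whittakerCharFun ψ ⟨y, hy.1⟩ * rsKernel hmn W W' s x := by
  have hf := isRightUInvariant_rsIntegrand hmn hW hW' s
  have hf' := isRightUInvariant_rsIntegrand hmn (ψ := ψ) (W := fun x => W (x * y)) (W' := W')
    (leftEquivariant_rightTranslate_aux hW y) hW' s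
  induction x using QuotientGroup.induction_on with
  | H g => rw [rsKernel_mk hmn hf' g, rsKernel_mk hmn hf g, rsIntegrand_rightTranslate_unipotentY hmn hW W' s hy g]

variable [MeasurableSpace (GL (Fin m) F ⧸ upperUnitriangular (Fin m) F)]
  (ν : Measure (GL (Fin m) F ⧸ upperUnitriangular (Fin m) F))

/-- **`(Y_{n,m}, ψ_U)`-equivariance of the local Rankin–Selberg zeta integral**
(Jacquet–Piatetski-Shapiro–Shalika 1983, §2.7; Cogdell 2004, §6.3 (ii)): for `W`, `W'`
left-equivariant under `(U_n, ψ_U)`, `(U_m, ψ⁻¹_U)` (e.g. Whittaker functions of `π`, `π'`),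
every `y ∈ Y_{n,m}`, every measure `ν` on `GL_m(F) ⧸ U_m` and EVERY `s`,
`Ψ(s; ρ(y) W, W') = ψ_U(y) Ψ(s; W, W')` (pointwise in the integrand; no convergence needed).
Together with `rsZeta_rightTranslate` (property (i)) this exhibits `(W, W') ↦ Ψ(s; W, W')` as a
quasi-invariant form of the type considered in the uniqueness principle (Cogdell 2004, Prop. 6.4)
behind the local functional equation. [cite: Cogdell2004, §6.3] -/
theorem rsZeta_rightTranslate_unipotentY (hmn : m < n) {ψ : AddChar F Circle}
    {W : GL (Fin n) F → ℂ} {W' : GL (Fin m) F → ℂ}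
    (hW : ∀ (u : ↥(upperUnitriangular (Fin n) F)) (g : GL (Fin n) F),
      W ((u : GL (Fin n) F) * g) = whittakerCharFun ψ u * W g)
    (hW' : ∀ (u : ↥(upperUnitriangular (Fin m) F)) (g : GL (Fin m) F),
      W' ((u : GL (Fin m) F) * g) = whittakerCharFun ψ⁻¹ u * W' g)
    (s : ℂ) {y : GL (Fin n) F} (hy : y ∈ unipotentY F n m) :
    rsZeta hmn ν (fun g => W (g * y)) W' s = whittakerCharFun ψ ⟨y, hy.1⟩ * rsZeta hmn ν W W' s := by
  simp only [rsZeta]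
  have hpt : (fun x => rsKernel hmn (fun g => W (g * y)) W' s x) =
      fun x => whittakerCharFun ψ ⟨y, hy.1⟩ * rsKernel hmn W W' s x :=
    funext fun x => rsKernel_rightTranslate_unipotentY hmn hW hW' s hy x
  rw [hpt, integral_const_mul]

/-- The same for Whittaker functions `W ∈ 𝒲_n(ψ)`, `W' ∈ 𝒲_m(ψ⁻¹)` (`whittakerSpace`).
[cite: Cogdell2004, §6.3] -/
theorem rsZeta_rightTranslate_unipotentY_of_mem_whittakerSpace (hmn : m < n) {ψ : AddChar F Circle}
    {W : GL (Fin n) F → ℂ} {W' : GL (Fin m) F → ℂ} (hW : W ∈ whittakerSpace n F ψ)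
    (hW' : W' ∈ whittakerSpace m F ψ⁻¹) (s : ℂ) {y : GL (Fin n) F} (hy : y ∈ unipotentY F n m) :
    rsZeta hmn ν (fun g => W (g * y)) W' s = whittakerCharFun ψ ⟨y, hy.1⟩ * rsZeta hmn ν W W' s :=
  rsZeta_rightTranslate_unipotentY ν hmn hW.1 hW'.1 s hy

end Equivariance

end Literature.NumberTheory.Automorphic
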